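import Summits.BirchSwinnertonDyer.Rank1Residual.X11b.CastellaErratumVersionOfRecordEndForm
import Summits.BirchSwinnertonDyer.Rank1Residual.X11b.LocalTorsionTamagawa
import Summits.BirchSwinnertonDyer.Rank1Residual.X11b.BDPRouteWholeClass
import HarnessLib

/-!
# X11b — route R1 (Castella 2018 Thm. A re-proved along the author's erratum): the STATEMENT OF RECORD after gens 1–7

HONEST FRAMING (cell `b2b-bsdres`, run/shared/lean/b2b/bsd-rank1-residual/, verbatim in every
file): the goal of the cell is to DELETE the COMBINATION-SHAPED residual classes of the
Birch–Swinnerton-Dyer formula for ALL analytic-rank `≤ 1` elliptic curves over `ℚ` — "full BSD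
formula for every rank `≤ 1` curve in class `C`" assembled STRICTLY from published theorems — so
that the rank-`≤ 1` remainder becomes exactly the CONSTRUCTION-SHAPED classes, which are TYPED
(missing-input `Prop`s), NOT attempted. This is not "finishing BSD". Sub-cell
`b2b-bsdres-multr1-p1` (X11b, route R1); a RESEARCH ROUTE; no claim beyond the stated class; X11b
stays CONSTRUCTION-SHAPED; nothing here changes a label; no named fact (two `Prop`-valued
predicates naming the route's population and its one open input, and theorems; no `sorry`).

## The route in one statement

`X11b = r_an = 1 ∧ p ≠ 2 ∧ mult(p) ∧ irr(p)`. Route R1 is Castella, Camb. J. Math. 6 (2018) §5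
("the same argument as in [Cas18, §5]", erratum p. 1) re-assembled in the kernel from its pieces,
for ARBITRARY conductor, with the withdrawn step (Cas18 Thm. 4.4 ⇐ Thm. 4.2's point `φ ∈ 𝒳_𝕀^a`)
replaced by the erratum's Thm. 1.1 and every other step either PROVED as a tree theorem or taken
as a PUBLISHED named fact. This file only NAMES the end state (the proofs are in the
`CastellaErratum*.lean` files of gens 1–7) so that the cell's documents cite ONE declaration:

* `R1Population W p` — the pairs the route reaches: `ChainLocus W p` (`5 ≤ p`, multiplicative at
  `p`, `E[p]` irreducible, a NON-SPLIT multiplicative `q ≠ p` with `p ∤ v_q(Δ_min)`, a further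
  multiplicative `ℓ ∉ {p, q}` with `p ∤ v_ℓ(Δ_min)`, `E(ℚ_p)[p] = 0`) together with an ODD such `q`
  ([Cas20, Thm. 2.11] is printed for odd `D_K` only). Census (`N < 5·10⁵`, Cremona, all
  `2 267 348` X11b-shape rank-one pairs at `p ≥ 5`; HOME/b2b-bsdres-multr1-p1/census500k/):
  `ChainLocus` `1 357 341` (`59.9 %`), of which `1 234 205` (`90.9 %`) have an odd `q`; the
  local-torsion clause is a THEOREM unless `p` is split with `p ∣ v_p(Δ_min)` (gen 6) and that
  residue lies inside `p ∣ ∏ c` (gen 7).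
* `R1OpenInputAt W p` — THE open input at the pair, "(A|VoR)": Castella's display (5.3)
  `ord_p #Ш(E/K)[p^∞] = 2·ord_p[E(K) : ℤP] − ord_p ∏_w c_w(E/K)` at the Heegner point `P` of a
  modular parametrisation datum of level `N_E` with `p ∤ c(datum)`, over an ERRATUM FIELD `K`
  (the `K` of Cas18 §5: `q` ramified, every other prime of `N_E` split, `2` split if `2 ∤ N_E`,
  `L(E^{(d_K)},1) ≠ 0`) satisfying [Cas20, §2.5]'s standing hypotheses VERBATIM at the tame level
  `N_E/p` (`Cas20Standing`: odd `−D_K < −3`, `p > 2` split, (heeg) `𝒪_K/𝔑 ≃ ℤ/(N_E/p)`, `p ∤ N_E/p`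
  — all of which are THEOREMS on such a field, `IsErratumField.cas20Standing`; they are displayed
  because they are where the input is printed). Printed derivation of (A|VoR): [Cas18, Thm. 2.3
  (control, PUB ⇐ JSW17) and Thm. 3.2 (BDP formula, PUB)] ∘ erratum Thm. 1.1 (UNREFEREED) ⇐
  erratum Thm. 2.3 ⇐ [FW21, Thm. 4.41] (Fouquet–Wan arXiv:2107.13726, PREPRINT) + Hida theory
  (a), (b) + (c) = [Cas20, Thm. 2.11] (PUB, inside its hypotheses) + the limiting argument and
  Lemmas 2.1–2.2 of erratum p. 4 (KERNEL-CHECKED as commutative algebra, gens 3–5: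
  `CastellaErratumThm11Skeleton`, `FittingOfNoFiniteSubmodule*`, `CongruenceLimit*`,
  `SelmerTorsionControl`, `InvariantsSocleCriterion`, …). NEVER a theorem here.
* **`R1.bsdp`** — for every globally minimal elliptic `W/ℚ` and prime `p` with `R1Population W p`
  and `ord_{s=1} L(E,s) = 1`: `BSD(E,p)` (Miller's `BSDp`), from the NINE PUBLISHED named facts
  `hGZ` (Gross–Zagier 1986 Thm. I.7.3), `hGZK` (Gross–Zagier–Kolyvagin over `ℚ`), `hSk` (Skinner
  2016 Thm. C, for the twist `E^D` — consumes the second ramified prime `ℓ`), `hmod` (modularity,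
  BCDT 2001), `hCST` (Cai–Shu–Tian 2014 Thm. 1.1, explicit Gross–Zagier under the general Heegner
  condition), `hFH` (Friedberg–Hoffstein 1995 Thm. B, special case: the erratum field exists),
  `hMaz` (Mazur 1978 Cor. 4.1: Manin constant a unit at odd `p ∥ N`), `hNS` (Néron mapping
  property: integrality of the Néron scaling of a rational isogeny) and the OPEN `R1OpenInputAt`;
  everything else — the GZ paraphrase (B), the Tamagawa relation (C), `Ш(E/K) = Ш(E)·Ш(E^D)` on
  `p`-parts, twist transport, the Heegner point of the erratum field, the Manin package, the
  hypotheses (i)–(iv) of Thm. 1.1 and FW21's "absolutely irreducible" — is a tree theorem;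
  the open input enters as `hA : ∀ W p, R1OpenInputAt W p`.
  `R1.bsdp_classX11b` records that the population consists of X11b pairs; `R1.bsdp_of_witnesses`
  is the census-column (data-level) form.
* **`bsdp_of_classX11b_five_of_typedInputs_twoRoutes`** — the TWO sub-cells' routes in ONE
  whole-class statement: multr1-p2's `bsdp_of_classX11b_five_of_typedInputs` (twelve published
  facts + typed inputs (T1) STEP L, (T2) upper half where `p ∣ ∏c`, (T3) X11a's lower half, (T4)
  the non-surjective corner) with **(T2) required only OFF route R1's population** — on
  `R1Population ∩ {p ∣ ∏c}` the upper half comes from `R1.bsdp` (⇐ `R1OpenInputAt`, which has a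
  printed, if unrefereed, derivation, whereas (T2) has none in print). Census `N < 5·10⁵`: (T2) =
  `64 130` pairs with `p ∣ ∏c` (61 998 with a (ram) prime), of which `32 726` lie on R1's
  population ⇒ the residual typed input (T2∖R1) is `31 404` pairs; R1 alone reaches `10 326` of the
  `21 289` (T2α) pairs (split at `p`, `p ∣ v_p(Δ_min)`) for which multr1-p2 GEN 9 records "no
  printed road".

What R1 does NOT reach (bookkeeping, labels unchanged): `p = 3` (A′ is `p > 3`); pairs all of whose
ramified multiplicative primes are split (no `q`; Cai–Shu–Tian's sign: `L(E^D,1) = 0` for every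
admissible `D`); A′-pairs without a second ramified multiplicative prime (Skinner Thm. C (ii) for
`E^D` unavailable as printed, flag `CAS18-ERR-ram2`); the `q = 2` corner (even `D_K`, outside
[Cas20]'s "odd discriminant"); split `p` with `p ∣ v_p(Δ_min)` and `E(ℚ_p)[p] ≠ 0`. Complement:
multr1-p2's route (BDP + Kolyvagin, one-sided) on `Locus = 5 ≤ p ∧ Ram ∧ p ∤ ∏ c` (`92.3 %`).

References: [Castella2018] §5; [Castella2018Erratum] Thm. 1.1, Thm. A′, §2; [Castella2020JIMJ]
§2.5, Thm. 2.11 (version of record); [FouquetWan2021] Thm. 4.41; [Skinner2016PacificMC] Thm. C;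
[CaiShuTian2014] Thm. 1.1; [FriedbergHoffstein1995] Thm. B; [GrossZagier1986] Thm. I.7.3;
[Mazur1978] Cor. 4.1. Cell record: HOME/b2b-bsdres-multr1-p1/REPORT.md §§0–17.
-/

noncomputable section

open scoped Classical

open WeierstrassCurve NumberField Literature.NumberTheory.EllipticCurves
  Literature.NumberTheory.EllipticCurves.ModularForms
  Literature.NumberTheory.EllipticCurves.Rank1Residual
  Literature.NumberTheory.EllipticCurves.Rank1Residual.Typed
  Literature.NumberTheory.EllipticCurves.Wuthrich2014

namespace Summit.BirchSwinnertonDyer.Rank1Residual.X11b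

/-- **The population of route R1**: `ChainLocus W p` (the hypotheses of the erratum's Thm. A′ at
`p ≥ 5` together with a second ramified multiplicative prime) and an ODD prime `q ≠ p` of non-split
multiplicative reduction with `p ∤ v_q(Δ_min)` (the prime to be ramified in the auxiliary field;
odd because [Cas20, Thm. 2.11] is printed for odd `D_K`). A predicate on `(W, p)`; nothing asserted.
[cite: Castella2018Erratum, Thm. A′ (p. 1) and Thm. 1.1 (iii) (shape only; nothing asserted)]
[cite: Castella2020JIMJ, §2.5 (author PDF p. 8) "odd discriminant" (shape only; nothing asserted)] -/
def R1Population (W : WeierstrassCurve ℚ) [W.IsGloballyMinimal] (p : ℕ) [Fact p.Prime] : Prop :=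
  ChainLocus W p ∧
    ∃ (q : ℕ) (_ : Fact q.Prime), q ≠ 2 ∧ q ≠ p ∧ Mult W q ∧
      ¬ W.HasSplitMultiplicativeReductionAtPrime q ∧ ¬ p ∣ padicValInt q W.minimalDiscriminantInt

/-- **THE open input of route R1 at the pair `(E, p)`, "(A|VoR)"**: Castella's display (5.3) —
`ord_p #Ш(E/K)[p^∞] = 2·ord_p[E(K):ℤP] − ord_p ∏_w c_w(E/K)` (`Display53At`) — at the Heegner point
`P` (of infinite order) of a modular parametrisation datum `Dt` of level `N_E` with `p ∤ c(Dt)`,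
whenever the pair is on the A′-hypotheses with `ord_{s=1}L(E,s) = 1`, for every non-split
multiplicative `q ≠ p` with `p ∤ v_q(Δ_min)` and every ERRATUM FIELD `K` for `q` satisfying
[Cas20, §2.5]'s standing hypotheses at the tame level `N_E/p` (`Cas20Standing`). Printed
derivation: [Cas18, Thms. 2.3, 3.2] ∘ erratum Thm. 1.1 (UNREFEREED; ⇐ [FW21, Thm. 4.41], PREPRINT,
+ (a), (b), (c) = [Cas20, Thm. 2.11]). A predicate on `(W, p)`; NEVER a theorem in this cell; every
result using it is CONDITIONAL. [claim: Castella2018Erratum, status: under-review] -/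
def R1OpenInputAt (W : WeierstrassCurve ℚ) [W.IsElliptic] [W.IsGloballyMinimal] (p : ℕ)
    [Fact p.Prime] : Prop :=
  ∀ [NeZero (W.conductorNorm ℤ)] (q : ℕ) [Fact q.Prime] (K : Type) [Field K] [NumberField K]
    (Dt : ModularParametrizationData W (W.conductorNorm ℤ))
    (H : HeegnerDatum (W.conductorNorm ℤ) (NumberField.discr K)) (ι : K →+* ℂ)
    (P : (W.baseChange K).toAffine.Point),
    ErratumHypotheses W p → W.analyticRank = 1 → q ≠ p → Mult W q →
    ¬ W.HasSplitMultiplicativeReductionAtPrime q → ¬ p ∣ padicValInt q W.minimalDiscriminantInt →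
    IsErratumField W K q → Cas20Standing K p (W.conductorNorm ℤ / p) →
    WeierstrassCurve.Affine.Point.map ι.toRatAlgHom P = heegnerPointComplex Dt H →
    ¬ (p : ℤ) ∣ Dt.c → ¬ IsOfFinAddOrder P → Display53At W p K P

/-- A pair of the population with `ord_{s=1}L(E,s) = 1` is an X11b pair. [folklore] -/
theorem R1Population.classX11b {W : WeierstrassCurve ℚ} [W.IsGloballyMinimal] {p : ℕ}
    [Fact p.Prime] (h : R1Population W p) (hr : W.analyticRank = 1) : ClassX11b W p :=
  h.1.classX11b hr

/-- **The population from census columns**: `5 ≤ p`, multiplicative at `p`, `E[p]` irreducible,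
reduction at `p` non-split OR `p ∤ v_p(Δ_min)`, an odd non-split multiplicative `q ≠ p` with
`p ∤ v_q(Δ_min)`, a multiplicative `ℓ ∉ {p, q}` with `p ∤ v_ℓ(Δ_min)` ⟹ `R1Population W p` (the
local-torsion clause is a theorem there, `chainLocus_of_witnesses`).
[cite: Castella2018Erratum, Thm. A′ (p. 1) and Remark (p. 2)] -/
theorem r1Population_of_witnesses (W : WeierstrassCurve ℚ) [W.IsElliptic] [W.IsGloballyMinimal]
    (p : ℕ) [Fact p.Prime] (hp : 5 ≤ p) (hmult : Mult W p) (hirr : Irr W p)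
    (hloc : ¬ W.HasSplitMultiplicativeReductionAtPrime p ∨ ¬ p ∣ padicValInt p W.minimalDiscriminantInt)
    {q : ℕ} [Fact q.Prime] {ℓ : ℕ} [Fact ℓ.Prime] (hq2 : q ≠ 2) (hqp : q ≠ p) (hℓp : ℓ ≠ p)
    (hℓq : ℓ ≠ q) (hmq : Mult W q) (hnsq : ¬ W.HasSplitMultiplicativeReductionAtPrime q)
    (hvq : ¬ p ∣ padicValInt q W.minimalDiscriminantInt)
    (hmℓ : Mult W ℓ) (hvℓ : ¬ p ∣ padicValInt ℓ W.minimalDiscriminantInt) : R1Population W p :=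
  ⟨chainLocus_of_witnesses W p hp hmult hirr hloc hqp hℓp hℓq hmq hnsq hvq hmℓ hvℓ,
    ⟨q, ‹_›, hq2, hqp, hmq, hnsq, hvq⟩⟩

/-- **The population from census columns on `p ∤ ∏ c`** (multr1-p2's `Locus` side): there the
local-torsion clause needs no condition at `p` (`LocalTorsion.chainLocus_of_witnesses_of_not_dvd_tamagawaProduct`).
[cite: Castella2018Erratum, Thm. A′ (p. 1) and Remark (p. 2)] -/
theorem r1Population_of_witnesses_of_not_dvd_tamagawaProduct (W : WeierstrassCurve ℚ) [W.IsElliptic]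
    [W.IsGloballyMinimal] (p : ℕ) [Fact p.Prime] (hp : 5 ≤ p) (hmult : Mult W p) (hirr : Irr W p)
    (htam : ¬ p ∣ W.tamagawaProduct)
    {q : ℕ} [Fact q.Prime] {ℓ : ℕ} [Fact ℓ.Prime] (hq2 : q ≠ 2) (hqp : q ≠ p) (hℓp : ℓ ≠ p)
    (hℓq : ℓ ≠ q) (hmq : Mult W q) (hnsq : ¬ W.HasSplitMultiplicativeReductionAtPrime q)
    (hvq : ¬ p ∣ padicValInt q W.minimalDiscriminantInt)
    (hmℓ : Mult W ℓ) (hvℓ : ¬ p ∣ padicValInt ℓ W.minimalDiscriminantInt) : R1Population W p :=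
  ⟨LocalTorsion.chainLocus_of_witnesses_of_not_dvd_tamagawaProduct W p hp hmult hirr htam hqp hℓp
      hℓq hmq hnsq hvq hmℓ hvℓ,
    ⟨q, ‹_›, hq2, hqp, hmq, hnsq, hvq⟩⟩

/-- **Route R1 — statement of record.** For every globally minimal elliptic `W/ℚ` and prime `p` on
the route's population with `ord_{s=1} L(E,s) = 1`: Miller's `BSD(E,p)`, from NINE PUBLISHED named
facts — `hGZ` Gross–Zagier 1986 Thm. I.7.3, `hGZK` Gross–Zagier–Kolyvagin, `hSk` Skinner 2016
Thm. C, `hmod` modularity, `hCST` Cai–Shu–Tian 2014 Thm. 1.1, `hFH` Friedberg–Hoffstein 1995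
Thm. B (special case), `hMaz` Mazur 1978 Cor. 4.1, `hNS` the Néron mapping property — and the ONE
open input `∀ W p, R1OpenInputAt W p` (the display (5.3) over erratum fields meeting [Cas20, §2.5]
⇐ erratum Thm. 1.1 ⇐ [FW21, Thm. 4.41], PREPRINT). All other links of Castella §5 are tree theorems
(`forall_bsdp_of_display_versionOfRecord` and the files it rests on). CONDITIONAL on
`R1OpenInputAt`; deletes nothing; X11b stays CONSTRUCTION-SHAPED.
[cite: Castella2018, §5 (arXiv:1704.06608 p. 12)] [cite: Castella2018Erratum, Thm. 1.1, Thm. A′ (p. 1), proof of Thm. 1.1 (p. 4)]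
[cite: Castella2020JIMJ, §2.5 (author PDF p. 8) and Thm. 2.11 (p. 12)] -/
theorem R1.bsdp
    (hGZ : GrossZagier1986_thm_I_7_3) (hGZK : rank_eq_analyticRank_of_analyticRank_le_one)
    (hSk : Skinner2016.thmC_padicValRat_bsd_rank_zero) (hmod : exists_isNewformOf)
    (hCST : CaiShuTian2014.thm11_trivialChar)
    (hFH : friedbergHoffstein_exists_twist_ne_zero_ramifiedAt)
    (hMaz : mazur_not_dvd_maninConstant_of_odd) (hNS : integral_neronScaling_of_isGloballyMinimal)
    (hA : ∀ (W : WeierstrassCurve ℚ) [W.IsElliptic] [W.IsGloballyMinimal] (p : ℕ) [Fact p.Prime],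
      R1OpenInputAt W p)
    (W : WeierstrassCurve ℚ) [W.IsElliptic] [W.IsGloballyMinimal] (p : ℕ) [Fact p.Prime]
    (hW : R1Population W p) (hr : W.analyticRank = 1) : BSDp W p :=
  forall_bsdp_of_display_versionOfRecord hGZ hGZK hSk hmod hCST hFH hMaz hNS
    (fun W _ _ _ p _ q _ K _ _ Dt H ι P ↦ hA W p q K Dt H ι P) W p hW.1 hW.2 hr

/-- The same, recording that the pair is an X11b pair (the class the route serves). [folklore] -/
theorem R1.bsdp_classX11b
    (hGZ : GrossZagier1986_thm_I_7_3) (hGZK : rank_eq_analyticRank_of_analyticRank_le_one)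
    (hSk : Skinner2016.thmC_padicValRat_bsd_rank_zero) (hmod : exists_isNewformOf)
    (hCST : CaiShuTian2014.thm11_trivialChar)
    (hFH : friedbergHoffstein_exists_twist_ne_zero_ramifiedAt)
    (hMaz : mazur_not_dvd_maninConstant_of_odd) (hNS : integral_neronScaling_of_isGloballyMinimal)
    (hA : ∀ (W : WeierstrassCurve ℚ) [W.IsElliptic] [W.IsGloballyMinimal] (p : ℕ) [Fact p.Prime],
      R1OpenInputAt W p)
    (W : WeierstrassCurve ℚ) [W.IsElliptic] [W.IsGloballyMinimal] (p : ℕ) [Fact p.Prime]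
    (hW : R1Population W p) (hr : W.analyticRank = 1) : ClassX11b W p ∧ BSDp W p :=
  ⟨hW.classX11b hr, R1.bsdp hGZ hGZK hSk hmod hCST hFH hMaz hNS hA W p hW hr⟩

/-- **Route R1 at the data level** (census columns on `(E, p)` only + NINE published facts + the
open input). [cite: Castella2018Erratum, Thm. 1.1 and Thm. A′ (p. 1), Remark (p. 2)] -/
theorem R1.bsdp_of_witnesses
    (hGZ : GrossZagier1986_thm_I_7_3) (hGZK : rank_eq_analyticRank_of_analyticRank_le_one)
    (hSk : Skinner2016.thmC_padicValRat_bsd_rank_zero) (hmod : exists_isNewformOf)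
    (hCST : CaiShuTian2014.thm11_trivialChar)
    (hFH : friedbergHoffstein_exists_twist_ne_zero_ramifiedAt)
    (hMaz : mazur_not_dvd_maninConstant_of_odd) (hNS : integral_neronScaling_of_isGloballyMinimal)
    (hA : ∀ (W : WeierstrassCurve ℚ) [W.IsElliptic] [W.IsGloballyMinimal] (p : ℕ) [Fact p.Prime],
      R1OpenInputAt W p)
    (W : WeierstrassCurve ℚ) [W.IsElliptic] [W.IsGloballyMinimal] (p : ℕ) [Fact p.Prime]
    (hp : 5 ≤ p) (hmult : Mult W p) (hirr : Irr W p)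
    (hloc : ¬ W.HasSplitMultiplicativeReductionAtPrime p ∨ ¬ p ∣ padicValInt p W.minimalDiscriminantInt)
    (hr : W.analyticRank = 1)
    {q : ℕ} [Fact q.Prime] {ℓ : ℕ} [Fact ℓ.Prime] (hq2 : q ≠ 2) (hqp : q ≠ p) (hℓp : ℓ ≠ p)
    (hℓq : ℓ ≠ q) (hmq : Mult W q) (hnsq : ¬ W.HasSplitMultiplicativeReductionAtPrime q)
    (hvq : ¬ p ∣ padicValInt q W.minimalDiscriminantInt)
    (hmℓ : Mult W ℓ) (hvℓ : ¬ p ∣ padicValInt ℓ W.minimalDiscriminantInt) : BSDp W p :=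
  R1.bsdp hGZ hGZK hSk hmod hCST hFH hMaz hNS hA W p
    (r1Population_of_witnesses W p hp hmult hirr hloc hq2 hqp hℓp hℓq hmq hnsq hvq hmℓ hvℓ) hr

/-- **The A′ binder taken whole still settles the population** (it needs neither the second prime
nor the field): consistency with `routeGoal_of_thmAprime_OPEN`. [claim: Castella2018Erratum, status: under-review] -/
theorem R1.bsdp_of_thmAprime_OPEN
    (hA' : Castella2018.erratum_thmAprime_padicVal_bsd_rankOne_OPEN)
    (hGZK : rank_eq_analyticRank_of_analyticRank_le_one)
    (W : WeierstrassCurve ℚ) [W.IsElliptic] [W.IsGloballyMinimal] (p : ℕ) [Fact p.Prime]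
    (hW : R1Population W p) (hr : W.analyticRank = 1) : BSDp W p :=
  routeGoal_of_thmAprime_OPEN hA' hGZK W p hW.1 hr

/-! ### The two sub-cells' routes in one whole-class statement -/

/-- **X11b, whole class at `p ≥ 5`, BOTH routes: multr1-p2's typed-input theorem with its (T2) input
required only OFF route R1's population.** For every `(E, p)` in X11b with `p ≥ 5`: `BSD(E,p)`, from
the PUBLISHED named facts of both routes (`hGZ hKo hB hSk hWu hGZK hmod hnf hHL hFH hMaz hNS` of
`bsdp_of_classX11b_five_of_typedInputs`; `hGZ1 hCST hFHr` of `R1.bsdp`), the typed inputs (T1) STEP L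
(`hL`), (T3) X11a's lower half (`hX11a`), (T4) the non-surjective corner (`hC`) as before, route R1's
open input `hA : ∀ W p, R1OpenInputAt W p` (⇐ erratum Thm. 1.1 ⇐ [FW21, Thm. 4.41], PREPRINT), and
the RESIDUAL Euler-system input (T2∖R1) `hU'` = the upper half `Typed.MissingUpperBoundAt` only at
pairs with `p ∣ ∏_ℓ c_ℓ(E)` that are NOT on `R1Population` (census `N < 5·10⁵`: 31 404 of the
64 130 pairs with `p ∣ ∏c`). Proof: feed multr1-p2's theorem the input (T2) assembled from `R1.bsdp`
(`BSDp ⟹ MissingPPartAt ⟹` upper half, `Ш` finite by GZK) on the population and from `hU'` off it.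
CONDITIONAL; deletes nothing; X11b stays CONSTRUCTION-SHAPED; no label change.
[cite: JetchevSkinnerWan2017, §7.4.1–7.4.3 (pp. 30–31)] [cite: Castella2018Erratum, Thm. 1.1, Thm. A′ (p. 1)]
[cite: Castella2018, §5 (arXiv:1704.06608 p. 12)] [cite: Miller2011LMS, Def. 1.1] -/
theorem bsdp_of_classX11b_five_of_typedInputs_twoRoutes
    -- published inputs of multr1-p2's whole-class theorem
    (hGZ : ∀ (N : ℕ) [NeZero N] (W : WeierstrassCurve ℚ) (K : Type) [Field K] [NumberField K],
      gross_zagier N W K)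
    (hKo : ∀ (N : ℕ) [NeZero N] (W : WeierstrassCurve ℚ) (K : Type) [Field K] [NumberField K],
      kolyvagin N W K)
    (hB : ∀ (N : ℕ) [NeZero N] (W : WeierstrassCurve ℚ) (K : Type) [Field K] [NumberField K],
      Kolyvagin1990_padicValNat_card_sha_le N W K)
    (hSk : Skinner2016.thmC_padicValRat_bsd_rank_zero) (hWu : sha_dvd_analyticSha)
    (hGZK : rank_eq_analyticRank_of_analyticRank_le_one) (hmod : hasEntireLFunction_rat)
    (hnf : exists_isNewformOf) (hHL : HoffsteinLuo1997_exists_twist_L_one_ne_zero)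
    (hFH : friedbergHoffstein_exists_heegnerField_split_twist_ne_zero)
    (hMaz : mazur_not_dvd_maninConstant_of_odd) (hNS : integral_neronScaling_of_isGloballyMinimal)
    -- the further published inputs of route R1
    (hGZ1 : GrossZagier1986_thm_I_7_3) (hCST : CaiShuTian2014.thm11_trivialChar)
    (hFHr : friedbergHoffstein_exists_twist_ne_zero_ramifiedAt)
    -- (T1) STEP L, at the odd-`d_K` Heegner data of surjective X11b pairs (multr1-p2)
    (hL : ∀ (W : WeierstrassCurve ℚ) [W.IsElliptic] [W.IsGloballyMinimal] (p : ℕ) [Fact p.Prime]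
      (N : ℕ) [NeZero N] (K : Type) [Field K] [NumberField K]
      (Dt : ModularParametrizationData W N) (H : HeegnerDatum N (NumberField.discr K)) (ι : K →+* ℂ)
      (P : (W.baseChange K).toAffine.Point),
      ClassX11b W p → Surj W p → W.conductorNorm ℤ = N → IsImaginaryQuadratic K →
      Odd (NumberField.discr K) → ¬ (p : ℤ) ∣ NumberField.discr K → ¬ p ∣ Units.torsionOrder K →
      SatisfiesHeegnerHypothesis N K →
      (W.quadraticTwist (NumberField.discr K : ℚ)).entireLFunction 1 ≠ 0 →
      WeierstrassCurve.Affine.Point.map ι.toRatAlgHom P = heegnerPointComplex Dt H →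
      ¬ (p : ℤ) ∣ Dt.c → IndexLowerBoundAt W p K P)
    -- route R1's open input (A|VoR)
    (hA : ∀ (W : WeierstrassCurve ℚ) [W.IsElliptic] [W.IsGloballyMinimal] (p : ℕ) [Fact p.Prime],
      R1OpenInputAt W p)
    -- (T2∖R1) the Euler-system half where `p ∣ ∏ c_ℓ`, OFF route R1's population only
    (hU' : ∀ (W : WeierstrassCurve ℚ) [W.IsElliptic] [W.IsGloballyMinimal] (p : ℕ) [Fact p.Prime],
      ClassX11b W p → 5 ≤ p → p ∣ W.tamagawaProduct → ¬ R1Population W p →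
      Typed.MissingUpperBoundAt W p)
    -- (T3) the main-conjecture half on the rank-0 sister class X11a
    (hX11a : ∀ (Wd : WeierstrassCurve ℚ) [Wd.IsElliptic] [Wd.IsGloballyMinimal] (p : ℕ)
      [Fact p.Prime], ClassX11a Wd p → Typed.MissingLowerBoundAt Wd p)
    -- (T4) the non-surjective corner, both halves typed
    (hC : ∀ (W : WeierstrassCurve ℚ) [W.IsElliptic] [W.IsGloballyMinimal] (p : ℕ) [Fact p.Prime],
      ClassX11b W p → ¬ Surj W p → Typed.MissingPPartAt W p) :
    ∀ (W : WeierstrassCurve ℚ) [W.IsElliptic] [W.IsGloballyMinimal] (p : ℕ) [Fact p.Prime],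
      ClassX11b W p → 5 ≤ p → BSDp W p := by
  refine bsdp_of_classX11b_five_of_typedInputs hGZ hKo hB hSk hWu hGZK hmod hnf hHL hFH hMaz hNS hL
    ?_ hX11a hC
  intro W _ _ p _ hX hp5 ht
  by_cases hR : R1Population W p
  · have hb : BSDp W p := R1.bsdp hGZ1 hGZK hSk hnf hCST hFHr hMaz hNS hA W p hR hX.1
    haveI : Finite W.sha := (hGZK W (le_of_eq hX.1)).2
    exact (Typed.lower_and_upper_of_missingPPartAt W p (Typed.missingPPartAt_of_bsdp W p hb)).2
  · exact hU' W p hX hp5 ht hR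

end Summit.BirchSwinnertonDyer.Rank1Residual.X11b

end
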